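import Literature.Topology.FourManifolds.OneJetTransversality
import Literature.Topology.FourManifolds.IntrinsicFoldCriterion
import HarnessLib

/-!
# Cusp candidates: the degenerate critical points of rank `corank 1`, and their invariance

Topic `Literature/Topology/FourManifolds` (programme of the fact
`Literature.Topology.FourManifolds.exists_isSimplifiedBrokenLefschetzFibration`, Baykur–Saeki 2017, §2.1:
generic maps `X⁴ → Σ²` have folds and cusps).  At a critical point `x` of a map `g` into the
plane which is not a submersion, with cokernel covector `ℓ`, the kernel Hessian
`ℓ D²g(x)|_{Ker dg_x}` is either nondegenerate (a **fold point**, Golubitsky–Guillemin III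
Def. 4.1 / VI (2.1)(a)) or degenerate (a **cusp candidate**, VI (2.1)(b): the critical curve is
tangent to the kernel, `OneJetFoldDichotomy.lean`).  This file packages the second alternative
as a predicate and proves that it is a diffeomorphism invariant of the germ — the bookkeeping
needed to read it in adapted coordinates:

* `OneJet.IsCuspCandidateAt g x` — `dg_x` is not onto and for every cokernel covector `ℓ ≠ 0`
  the kernel Hessian has a non-zero radical vector;
* `OneJet.isCuspCandidateAt_congr_of_eventuallyEq` — locality;
* `OneJet.isCuspCandidateAt_comp_iff` — invariance under reparametrisations of the source
  (`θ` `C²` at `x` with invertible derivative);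
* `OneJet.isCuspCandidateAt_comp_target_iff` — invariance under local diffeomorphisms of the
  target.

Everything is proved; `IsCuspCandidateAt` is the only definition; no named fact (D-0026).

## References

* M. Golubitsky, V. Guillemin, *Stable Mappings and Their Singularities*, GTM 14 (1973), Ch. III
  Def. 4.1; Ch. VI §2, (2.1). [GolubitskyGuillemin1973]
* R. İ. Baykur, O. Saeki, *Simplifying indefinite fibrations on 4-manifolds*, arXiv:1705.11169,
  §2.1, p. 6. [BaykurSaeki2017]
-/

noncomputable section

open Set Function Filter
open scoped ContDiff Topology

namespace Literature.Topology.FourManifolds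

namespace OneJet

section

variable {E E' F F' : Type} [NormedAddCommGroup E] [NormedSpace ℝ E] [NormedAddCommGroup E']
  [NormedSpace ℝ E'] [NormedAddCommGroup F] [NormedSpace ℝ F] [NormedAddCommGroup F']
  [NormedSpace ℝ F']

/-- **Cusp candidate**: `x` is a critical point of `g` (`dg_x` not onto) at which, for every
cokernel covector `ℓ ≠ 0` (`ℓ ∘ dg_x = 0`), the kernel Hessian `ℓ D²g(x)|_{Ker dg_x}` is
degenerate: some non-zero `k₀ ∈ Ker dg_x` has `ℓ D²g(x)(k, k₀) = 0` for all `k ∈ Ker dg_x`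
(Golubitsky–Guillemin VI (2.1)(b), as opposed to the fold points (2.1)(a) / III Def. 4.1).
[cite: GolubitskyGuillemin1973, Ch. VI §2, (2.1)] -/
def IsCuspCandidateAt (g : E → F) (x : E) : Prop :=
  ¬ Surjective (fderiv ℝ g x) ∧
    ∀ ℓ : F →L[ℝ] ℝ, ℓ ≠ 0 → ℓ.comp (fderiv ℝ g x) = 0 →
      ∃ k₀ : E, k₀ ≠ 0 ∧ fderiv ℝ g x k₀ = 0 ∧
        ∀ k, fderiv ℝ g x k = 0 → ℓ (fderiv ℝ (fderiv ℝ g) x k k₀) = 0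

/-- Unfolding `IsCuspCandidateAt`. [folklore] -/
theorem isCuspCandidateAt_iff (g : E → F) (x : E) :
    IsCuspCandidateAt g x ↔
      ¬ Surjective (fderiv ℝ g x) ∧
        ∀ ℓ : F →L[ℝ] ℝ, ℓ ≠ 0 → ℓ.comp (fderiv ℝ g x) = 0 →
          ∃ k₀ : E, k₀ ≠ 0 ∧ fderiv ℝ g x k₀ = 0 ∧
            ∀ k, fderiv ℝ g x k = 0 → ℓ (fderiv ℝ (fderiv ℝ g) x k k₀) = 0 :=
  Iff.rfl

/-- Being a cusp candidate depends only on the germ of the map. [folklore] -/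
theorem isCuspCandidateAt_congr_of_eventuallyEq {g₁ g₂ : E → F} {x : E}
    (heq : g₁ =ᶠ[𝓝 x] g₂) : IsCuspCandidateAt g₁ x ↔ IsCuspCandidateAt g₂ x := by
  rw [isCuspCandidateAt_iff, isCuspCandidateAt_iff, heq.fderiv_eq, heq.fderiv.fderiv_eq]

/-- **Cusp candidacy is invariant under reparametrisation of the source**: if `θ` is `C²` at
`x` with invertible differential `A` and `g` is `C²` at `θ x`, then `x` is a cusp candidate of
`g ∘ θ` iff `θ x` is one of `g` (second-order chain rule; kernels correspond under `A`, cokernel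
covectors are the same). [folklore] -/
theorem isCuspCandidateAt_comp_iff {g : E → F} {θ : E' → E} {x : E'} (A : E' ≃L[ℝ] E)
    (hθ : HasFDerivAt θ (A : E' →L[ℝ] E) x) (hθ2 : ContDiffAt ℝ 2 θ x)
    (hg2 : ContDiffAt ℝ 2 g (θ x)) :
    IsCuspCandidateAt (g ∘ θ) x ↔ IsCuspCandidateAt g (θ x) := by
  have hgd : DifferentiableAt ℝ g (θ x) := hg2.differentiableAt (by simp)
  have hfd : fderiv ℝ (g ∘ θ) x = (fderiv ℝ g (θ x)).comp (A : E' →L[ℝ] E) := by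
    rw [fderiv_comp x hgd hθ.differentiableAt, hθ.fderiv]
  have hAθ : fderiv ℝ θ x = (A : E' →L[ℝ] E) := hθ.fderiv
  have hchain : ∀ (ℓ : F →L[ℝ] ℝ), ℓ.comp (fderiv ℝ g (θ x)) = 0 → ∀ v k : E',
      ℓ (fderiv ℝ (fderiv ℝ (g ∘ θ)) x v k) = ℓ (fderiv ℝ (fderiv ℝ g) (θ x) (A v) (A k)) := by
    intro ℓ hℓ v k
    rw [fderiv_fderiv_comp_apply_eq_add hg2 hθ2 v k, map_add, hAθ]
    have : ℓ (fderiv ℝ g (θ x) (fderiv ℝ (fderiv ℝ θ) x v k)) = 0 := by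
      simpa using congrArg (fun φ : E →L[ℝ] ℝ => φ (fderiv ℝ (fderiv ℝ θ) x v k)) hℓ
    rw [this, zero_add]
    rfl
  -- surjectivity and cokernel covectors correspond
  have hsurj : Surjective (fderiv ℝ (g ∘ θ) x) ↔ Surjective (fderiv ℝ g (θ x)) := by
    rw [hfd]
    constructor
    · intro h w
      obtain ⟨v, hv⟩ := h w
      exact ⟨A v, hv⟩
    · intro h w
      obtain ⟨v, hv⟩ := h w
      exact ⟨A.symm v, by simpa using hv⟩
  have hcok : ∀ ℓ : F →L[ℝ] ℝ,
      ℓ.comp (fderiv ℝ (g ∘ θ) x) = 0 ↔ ℓ.comp (fderiv ℝ g (θ x)) = 0 := by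
    intro ℓ
    rw [hfd]
    constructor
    · intro h
      ext u
      have := congrArg (fun φ : E' →L[ℝ] ℝ => φ (A.symm u)) h
      simpa using this
    · intro h
      rw [← ContinuousLinearMap.comp_assoc, h, ContinuousLinearMap.zero_comp]
  rw [isCuspCandidateAt_iff, isCuspCandidateAt_iff, hsurj]
  refine and_congr_right fun _ => forall_congr' fun ℓ => forall_congr' fun _ => ?_
  rw [hcok ℓ]
  refine forall_congr' fun hℓg => ?_
  constructor
  · rintro ⟨k₀, hk₀0, hk₀, hrad⟩
    refine ⟨A k₀, fun h0 => hk₀0 (A.injective (by rw [h0, map_zero])), ?_, fun k hk => ?_⟩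
    · rw [hfd] at hk₀
      exact hk₀
    · have h1 := hrad (A.symm k) (by rw [hfd]; simpa using hk)
      rw [hchain ℓ hℓg] at h1
      simpa using h1
  · rintro ⟨k₀, hk₀0, hk₀, hrad⟩
    refine ⟨A.symm k₀, fun h0 => hk₀0 ?_, ?_, fun k hk => ?_⟩
    · have := congrArg A h0
      simpa using this
    · rw [hfd]
      simpa using hk₀
    · rw [hchain ℓ hℓg]
      have hk' : fderiv ℝ g (θ x) (A k) = 0 := by
        rw [hfd] at hk
        exact hk
      simpa using hrad (A k) hk'

/-- **Cusp candidacy is invariant under local diffeomorphisms of the target**: if `ψ` is `C²`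
at `g x` with invertible differential `B` and `g` is `C²` at `x`, then `x` is a cusp candidate of
`ψ ∘ g` iff it is one of `g` (`D²(ψ ∘ g)(v, k) = B D²g(v, k) + D²ψ(dg v, dg k)`, the second term
vanishing for `k ∈ Ker dg_x`; cokernel covectors correspond by `ℓ ↦ ℓ ∘ B⁻¹`). [folklore] -/
theorem isCuspCandidateAt_comp_target_iff {g : E → F} {ψ : F → F'} {x : E} (B : F ≃L[ℝ] F')
    (hψ : HasFDerivAt ψ (B : F →L[ℝ] F') (g x)) (hψ2 : ContDiffAt ℝ 2 ψ (g x))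
    (hg2 : ContDiffAt ℝ 2 g x) :
    IsCuspCandidateAt (ψ ∘ g) x ↔ IsCuspCandidateAt g x := by
  have hgd : DifferentiableAt ℝ g x := hg2.differentiableAt (by simp)
  have hfd : fderiv ℝ (ψ ∘ g) x = (B : F →L[ℝ] F').comp (fderiv ℝ g x) := by
    rw [fderiv_comp x hψ.differentiableAt hgd, hψ.fderiv]
  have hD2 : ∀ v k, fderiv ℝ g x k = 0 →
      fderiv ℝ (fderiv ℝ (ψ ∘ g)) x v k = B (fderiv ℝ (fderiv ℝ g) x v k) := fun v k hk => by
    rw [fderiv_fderiv_comp_apply_eq_add hψ2 hg2 v k, hψ.fderiv, hk, map_zero, add_zero]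
    rfl
  have hker : ∀ k, fderiv ℝ (ψ ∘ g) x k = 0 ↔ fderiv ℝ g x k = 0 := fun k => by
    rw [hfd, ContinuousLinearMap.comp_apply]
    exact ⟨fun h => B.injective (by simpa using h), fun h => by simp [h]⟩
  have hsurj : Surjective (fderiv ℝ (ψ ∘ g) x) ↔ Surjective (fderiv ℝ g x) := by
    rw [hfd]
    constructor
    · intro h w
      obtain ⟨v, hv⟩ := h (B w)
      exact ⟨v, B.injective (by simpa using hv)⟩
    · intro h w
      obtain ⟨v, hv⟩ := h (B.symm w)
      exact ⟨v, by simp [hv]⟩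
  rw [isCuspCandidateAt_iff, isCuspCandidateAt_iff, hsurj]
  refine and_congr_right fun _ => ?_
  constructor
  · intro h ℓ hℓ hℓg
    -- the covector `ℓ ∘ B⁻¹` for `ψ ∘ g`
    have hℓ' : ℓ.comp (B.symm : F' →L[ℝ] F) ≠ 0 := by
      intro h0
      apply hℓ
      ext w
      have := congrArg (fun φ : F' →L[ℝ] ℝ => φ (B w)) h0
      simpa using this
    have hℓg' : (ℓ.comp (B.symm : F' →L[ℝ] F)).comp (fderiv ℝ (ψ ∘ g) x) = 0 := by
      rw [hfd]
      ext w
      have := congrArg (fun φ : E →L[ℝ] ℝ => φ w) hℓg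
      simpa using this
    obtain ⟨k₀, hk₀0, hk₀, hrad⟩ := h _ hℓ' hℓg'
    have hk₀' : fderiv ℝ g x k₀ = 0 := (hker k₀).1 hk₀
    refine ⟨k₀, hk₀0, hk₀', fun k hk => ?_⟩
    have h1 := hrad k ((hker k).2 hk)
    rw [hD2 k k₀ hk₀'] at h1
    simpa using h1
  · intro h ℓ' hℓ' hℓg'
    -- the covector `ℓ' ∘ B` for `g`
    have hℓ : ℓ'.comp (B : F →L[ℝ] F') ≠ 0 := by
      intro h0
      apply hℓ'
      ext w
      have := congrArg (fun φ : F →L[ℝ] ℝ => φ (B.symm w)) h0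
      simpa using this
    have hℓg : (ℓ'.comp (B : F →L[ℝ] F')).comp (fderiv ℝ g x) = 0 := by
      rw [ContinuousLinearMap.comp_assoc, ← hfd, hℓg']
    obtain ⟨k₀, hk₀0, hk₀, hrad⟩ := h _ hℓ hℓg
    refine ⟨k₀, hk₀0, (hker k₀).2 hk₀, fun k hk => ?_⟩
    rw [hD2 k k₀ hk₀]
    simpa using hrad k ((hker k).1 hk)

end

end OneJet

end Literature.Topology.FourManifolds
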